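import Literature.Barriers.CriticalPhenomena.WeaklySAWFlowTheoremDeriv
import Literature.Barriers.CriticalPhenomena.WeaklySAWPerturbativeFlowTheorem
import HarnessLib

/-!
# BBS 2015, Theorem 7.2.1(ii) for the 4d weakly self-avoiding walk, modulo (A3): the critical initial
# conditions `(z₀ᶜ, μ₀ᶜ)(m², g₀)` are differentiable in `g₀` with `O(1)` derivatives

Assembly file (like `WeaklySAWPerturbativeFlowTheorem.lean` for part (i) and Corollary 7.2.2): BBS 2015,
§7.2 applies [BBS-rg-flow, Theorem 1.4] to `φ̄ = wsawQuadFlow L m²` (for which (A1)–(A2) hold uniformly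
in `m² ∈ [0, δ]`, `BBS2015_hypA12_package`) and to the RG map `(ψ, ρ)` ONCE it satisfies (A3); part (ii)
of Theorem 7.2.1 ("`(z₀ᶜ, μ₀ᶜ)` are continuously differentiable in `g₀` with `∂z₀ᶜ/∂g₀, ∂μ₀ᶜ/∂g₀ = O(1)`",
the input of Proposition 7.1.1) is here obtained from `WeaklySAWFlowTheoremDeriv.lean`
(`hasDerivAt_critFlow`, `abs_deriv_critFlow_zero_le`):
* **`BBS2015_thm721_ii_of_hypA3`**: for `m² ∈ [0, δ]`, constants as in Theorem 1.4 (`ConstHyp`),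
  admissibility of `(m², K₀, g)` for `g` near `g₀` (e.g. `K₀ = 0`, `0 < g₀ < g_*`, (A3) along `V̄(m², g)`)
  and the smallness `8B²C_{2,0}g₀ < 1`: every scale of the critical flow is differentiable in `g₀` at
  `g₀`, and `|∂z₀ᶜ/∂g₀|, |∂μ₀ᶜ/∂g₀| ≤ 2K_e/(1-κΩ)` with `K_e = modeVConst(Ω, c, ⌊c⁻¹⌋, C, L²)` — a constant
  independent of `m²`, `g₀`, `𝗁`.
The continuity of the derivative and the joint regularity in `(K₀, g₀)` are not addressed
(TODO(general form)); (A3) for the WSAW RG map is [BS-rg-step] and is NOT proved here.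

## References
* R. Bauerschmidt, D. C. Brydges, G. Slade, CMP 338 (2015), arXiv:1403.7422: Theorem 7.2.1(ii),
  Proposition 7.1.1, §7.3 (Step 1). [BauerschmidtBrydgesSlade2015LogCorr]
* R. Bauerschmidt, D. C. Brydges, G. Slade, AHP 16 (2015), arXiv:1211.2477: Theorem 1.4(ii), (1.15).
  [BauerschmidtBrydgesSlade2015Flow]
-/

noncomputable section

open Set Filter Topology

namespace Literature.Barriers.CriticalPhenomena

namespace CTWSAW

/-- **BBS 2015, Theorem 7.2.1(ii), for the 4d weakly self-avoiding walk, modulo (A3)**: with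
`Pf m² = wsawQuadFlow L m²` (`m² ∈ [0, δ]`, (A1)–(A2) uniform), constants as in Theorem 1.4 with
`𝗁 ≥ 𝗁_*`, and `(m², K₀, g)` admissible for all `g` near `g₀` (`0 < g ≤ g_*`, `‖K₀‖ ≤ a_*g³`, (A3) along
`V̄(m², g)`), together with `8B²C_{2,0}g₀ < 1`: every scale `x_j(m², K₀, ·)` of the critical flow of
Theorem 7.2.1(i) is differentiable at `g₀`, and the initial conditions `z₀ᶜ = (x₀).2 1`, `μ₀ᶜ = (x₀).2 2`
obey `|∂z₀ᶜ/∂g₀|, |∂μ₀ᶜ/∂g₀| ≤ 2K_e/(1-κΩ)`, uniformly in `(m², g₀)`.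
[cite: BauerschmidtBrydgesSlade2015LogCorr, Theorem 7.2.1(ii)] [cite: BauerschmidtBrydgesSlade2015Flow, Theorem 1.4(ii), (1.15)] -/
theorem BBS2015_thm721_ii_of_hypA3 {L : ℝ} {δ Ω B c C : ℝ}
    (hA : ∀ m : massParams δ, HypA1 (wsawQuadFlow L (m : ℝ)).β Ω B c ∧ HypA2 (wsawQuadFlow L (m : ℝ)) Ω (L ^ 2) c C)
    {a κ R M aStar b hh : ℝ} (hc : ConstHyp Ω c (L ^ 2) C a κ R M aStar b hh)
    {W : ℕ → Type*} [∀ j, NormedAddCommGroup (W j)] [∀ j, NormedSpace ℝ (W j)] [∀ j, CompleteSpace (W j)]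
    (ψf : ∀ m : massParams δ, ∀ j, W j × V3 → W (j + 1)) (ρf : ∀ m : massParams δ, ∀ j, W j × V3 → V3)
    {m : massParams δ} {K₀ : W 0} {g₀ : ℝ}
    (hsmallD : 8 * B ^ 2 * ((1 + (⌊c⁻¹⌋₊ : ℝ)) / c + ⌊c⁻¹⌋₊ + 2 * Ω / (Ω - 1)) * g₀ < 1)
    (hadm : ∀ᶠ g in 𝓝 g₀,
      Adm (fun m : massParams δ => wsawQuadFlow L (m : ℝ)) ψf ρf Ω B c (L ^ 2) C a κ R M aStar b hh (m, K₀, g)) :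
    (∀ j, DifferentiableAt ℝ (fun g => critFlow ψf ρf hc hA (m, K₀, g) j) g₀) ∧
      DifferentiableAt ℝ (fun g => (critFlow ψf ρf hc hA (m, K₀, g) 0).2 1) g₀ ∧
      DifferentiableAt ℝ (fun g => (critFlow ψf ρf hc hA (m, K₀, g) 0).2 2) g₀ ∧
      |deriv (fun g => (critFlow ψf ρf hc hA (m, K₀, g) 0).2 1) g₀| ≤ 2 * modeVConst Ω c ⌊c⁻¹⌋₊ C (L ^ 2) / (1 - κ * Ω) ∧
      |deriv (fun g => (critFlow ψf ρf hc hA (m, K₀, g) 0).2 2) g₀| ≤ 2 * modeVConst Ω c ⌊c⁻¹⌋₊ C (L ^ 2) / (1 - κ * Ω) := by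
  obtain ⟨v, -, hD⟩ := hasDerivAt_critFlow ψf ρf hc hA hsmallD hadm
  obtain ⟨h1, h2, h3, h4⟩ := abs_deriv_critFlow_zero_le ψf ρf hc hA hsmallD hadm
  exact ⟨fun j => (hD j).differentiableAt, h1, h2, h3, h4⟩

end CTWSAW

end Literature.Barriers.CriticalPhenomena
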